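import Mathlib
import HarnessLib
import Literature.MathematicalPhysics.KineticTheory.VelocityFlipNoise
import Literature.MathematicalPhysics.KineticTheory.MomentumHermiteLadder
import Summits.AtomisticToContinuum.FouriersLaw.Theorems.VanishingNoiseTransferNoisyFourierPatternStorage

/-!
# The pairing identity of a classical Abel corrector of the flip-noisy pinned chain against a test function
# (line `abel-storage-decay`, crux `VanishingNoiseTransfer.NoisyFourier`, stmt-AtomisticToContinuum-11977, stub B)

`--supports stmt-AtomisticToContinuum-11977` file (worker B of lead c6), part 1 of the level-`s` Thomson lower
bound (part 2: `…NoisyFourierBulkPositivityOfWitnessFamily`). Setting as in `…NoisyFourierAbelTransfer`: the pinned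
anharmonic chain `𝐏 = pinnedChain ω₂ lam β γ` (parameters `> 0`), `T > 0`, Gibbs measure `μ_T = 𝐏.gibbsMeasure L T`
(density `ρ = e^{-H/T}`; invariant under every single-site momentum flip `F_i`), the flip-noisy equilibrium generator
`L_ε = 𝐏.flipGenerator L T T ε = X + γ S_B + ε S` (`X = 𝐏.liouvillian L` the Liouvillian = the Summit-level
`liouvilleOp`, `S_B` the two Ornstein–Uhlenbeck thermostats with weights `B = bathWeight L`, `S` Bernardin–Olla's
velocity flips), and CLASSICAL Abel correctors `u ∈ C² ∩ L²(μ_T)`, `L_ε u = s u − J` pointwise (`J ∈ L²(μ_T)`; for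
the line, `J = Σ_i j_i`). Write `E(f) = Σ_i ‖f∘F_i − f‖²` (flip Dirichlet energy) and `P₀` for the average over the
`2^L` momentum-sign patterns.

* `integral_mul_flipNoise_polar` — the polarised flip Dirichlet form `⟨g, Sf⟩ = −½ Σ_i ⟨g∘F_i − g, f∘F_i − f⟩`.
* `integral_mul_pattern_split` — `⟨u, g⟩ = ⟨u − P₀u, g⟩ + ⟨P₀u, P₀g⟩` (Efron–Stein orthogonality `flipAvg_orth`).
* `corrector_energy_eq` — the ENERGY IDENTITY `⟨u, J⟩ = s‖u‖² + (ε/2)E(u) + γT Σ_i B_i ‖∂_{p_i}u‖²`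
  (`Kubo.fluctuation_dissipation` for the forward pair `(u, (J − su) + εSu)`; the landed `corrector_energy_le` is
  its inequality shadow).
* `pairing_identity` — for a test function `w ∈ C²` with `w, Xw, L_{T,T}w ∈ L²(μ_T)`:
  `⟨J, w⟩ = s⟨u,w⟩ + (ε/2)Σ_i⟨u∘F_i − u, w∘F_i − w⟩ + ⟨u, Xw⟩ + γT Σ_i B_i⟨∂_{p_i}u, ∂_{p_i}w⟩`, i.e.
  `⟨(s − L_ε)u, w⟩` with `L_ε` moved across: `w` is a forward pair (source `−L_{T,T}w`) AND a backward pair (source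
  `Xw − γS_Bw`); average the landed `Kubo.polar` (two forward pairs) and `Kubo.cross` (forward against backward).
* `helper_abelCorrectorPairingIdentity` — registered notation-free restatement.

References: Bernardin–Olla 2011 §3, §5 (symmetric/antisymmetric parts of `L`); Eckmann–Pillet–Rey-Bellet 1999 §3;
folklore. No definitions; axioms `propext`, `Classical.choice`, `Quot.sound` only.
-/

noncomputable section

open MeasureTheory Filter Topology
open scoped BigOperators
open Literature.MathematicalPhysics.KineticTheory.HeatConduction
open Summit.AtomisticToContinuum.FouriersLaw.Theorems.SuperadditiveResistance.DeviceLiouville (liouvilleOp bathOp)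
open Summit.AtomisticToContinuum.FouriersLaw.Theorems.SuperadditiveResistance.Kubo
  (polar cross fluctuation_dissipation integrable_mul_mul_gibbsDensity)
open Summit.AtomisticToContinuum.FouriersLaw.Theorems.SuperadditiveResistance.KuboPlain
  (generator_eq_liouvilleOp_add_bathOp)
open Summit.AtomisticToContinuum.FouriersLaw.Theorems.VanishingNoiseBound
  (memLp_comp_momentumFlip memLp_flipNoise flip_forwardPair gibbs_flipInvariant)
open Summit.AtomisticToContinuum.FouriersLaw.Cruxes.NoisyFourier.AbelKapitzaEvenCorrector
  (exists_natFlip flipAvg_orth flipAvg_even flipAvg_memLp flipAvg_closed_form_top)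

namespace Summit.AtomisticToContinuum.FouriersLaw.Theorems.NoisyFourier.AbelThomson

/-! ## Abstract pieces: polarised flip Dirichlet form, pattern split, scalar Young inequality -/

section Abstract

variable {L : ℕ} {μ : Measure (PhaseSpace L)}

/-- **Polarised flip Dirichlet form.** For a flip-invariant measure `μ` and `f, g ∈ L²(μ)`:
`∫ g · S f dμ = −½ Σ_i ∫ (g∘F_i − g)(f∘F_i − f) dμ`. [cite: BernardinOlla2011, §2.1] -/
theorem integral_mul_flipNoise_polar (hμ : ∀ i, MeasurePreserving (momentumFlip i) μ μ)
    {f g : PhaseSpace L → ℝ} (hf : MemLp f 2 μ) (hg : MemLp g 2 μ) :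
    ∫ x, g x * flipNoise L f x ∂μ =
      -(1 / 2) * ∑ i, ∫ x, (g (momentumFlip i x) - g x) * (f (momentumFlip i x) - f x) ∂μ := by
  have hfi : ∀ i, MemLp (fun x => f (momentumFlip i x)) 2 μ := memLp_comp_momentumFlip hμ hf
  have hgi : ∀ i, MemLp (fun x => g (momentumFlip i x)) 2 μ := memLp_comp_momentumFlip hμ hg
  have hgf : Integrable (fun x => g x * f x) μ := hg.integrable_mul hf
  have hgfi : ∀ i, Integrable (fun x => g x * f (momentumFlip i x)) μ := fun i => hg.integrable_mul (hfi i)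
  have hgif : ∀ i, Integrable (fun x => g (momentumFlip i x) * f x) μ := fun i => (hgi i).integrable_mul hf
  have hgifi : ∀ i, Integrable (fun x => g (momentumFlip i x) * f (momentumFlip i x)) μ := fun i =>
    (hgi i).integrable_mul (hfi i)
  have hsq : ∀ i, ∫ x, g (momentumFlip i x) * f (momentumFlip i x) ∂μ = ∫ x, g x * f x ∂μ := fun i =>
    integral_comp_momentumFlip (hμ i) (fun x => g x * f x)
  have hsym : ∀ i, ∫ x, g (momentumFlip i x) * f x ∂μ = ∫ x, g x * f (momentumFlip i x) ∂μ := fun i =>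
    (integral_mul_comp_momentumFlip (hμ i) f g).symm
  have hterm : ∀ i, ∫ x, g x * (f (momentumFlip i x) - f x) ∂μ =
      -(1 / 2) * ∫ x, (g (momentumFlip i x) - g x) * (f (momentumFlip i x) - f x) ∂μ := by
    intro i
    have e1 : (fun x => g x * (f (momentumFlip i x) - f x)) =
        fun x => g x * f (momentumFlip i x) - g x * f x := by
      funext x; ring
    have e2 : (fun x => (g (momentumFlip i x) - g x) * (f (momentumFlip i x) - f x)) =
        fun x => (g (momentumFlip i x) * f (momentumFlip i x) - g (momentumFlip i x) * f x) -
          (g x * f (momentumFlip i x) - g x * f x) := by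
      funext x; ring
    have i12 : Integrable (fun x => g (momentumFlip i x) * f (momentumFlip i x) - g (momentumFlip i x) * f x) μ :=
      (hgifi i).sub (hgif i)
    have i34 : Integrable (fun x => g x * f (momentumFlip i x) - g x * f x) μ := (hgfi i).sub hgf
    rw [e1, e2, integral_sub i12 i34, integral_sub (hgifi i) (hgif i), integral_sub (hgfi i) hgf, hsq i, hsym i]
    ring
  have e : (fun x => g x * flipNoise L f x) = fun x => ∑ i, g x * (f (momentumFlip i x) - f x) := by
    funext x; rw [flipNoise_eq, Finset.mul_sum]
  rw [e, integral_finsetSum _ fun i _ => ?_, Finset.mul_sum]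
  · exact Finset.sum_congr rfl fun i _ => hterm i
  · have : (fun x => g x * (f (momentumFlip i x) - f x)) = fun x => g x * f (momentumFlip i x) - g x * f x := by
      funext x; ring
    rw [this]
    exact (hgfi i).sub hgf

/-- **Pattern split of an `L²` pairing.** For a flip-invariant measure and `u, g ∈ L²`:
`∫ u g = ∫ (u − P₀u) g + ∫ P₀u · P₀g` (`P₀u` is even in every momentum and `g − P₀g ⊥` such functions,
`flipAvg_orth`). [folklore] -/
theorem integral_mul_pattern_split (hμ : ∀ i : Fin L, MeasurePreserving (momentumFlip i) μ μ)
    {u g : PhaseSpace L → ℝ} (hu : MemLp u 2 μ) (hg : MemLp g 2 μ) :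
    ∫ x, u x * g x ∂μ =
      (∫ x, (u x - (∑ w : Fin L → Bool, u (x.1, fun i => if w i then -x.2 i else x.2 i)) / 2 ^ L) * g x ∂μ) +
        ∫ x, ((∑ w : Fin L → Bool, u (x.1, fun i => if w i then -x.2 i else x.2 i)) / 2 ^ L) *
          ((∑ w : Fin L → Bool, g (x.1, fun i => if w i then -x.2 i else x.2 i)) / 2 ^ L) ∂μ := by
  obtain ⟨θ, hθfin, hθμ, hθi, hθc⟩ := exists_natFlip L μ hμ
  obtain ⟨F, hF0, hFs⟩ : ∃ F : ℕ → PhaseSpace L → ℝ,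
      (∀ x, F 0 x = u x) ∧ ∀ k x, F (k + 1) x = (F k x + F k (θ k x)) / 2 :=
    ⟨fun n => Nat.rec u (fun k Fk x => (Fk x + Fk (θ k x)) / 2) n, fun _ => rfl, fun _ _ => rfl⟩
  obtain ⟨G, hG0, hGs⟩ : ∃ G : ℕ → PhaseSpace L → ℝ,
      (∀ x, G 0 x = g x) ∧ ∀ k x, G (k + 1) x = (G k x + G k (θ k x)) / 2 :=
    ⟨fun n => Nat.rec g (fun k Gk x => (Gk x + Gk (θ k x)) / 2) n, fun _ => rfl, fun _ _ => rfl⟩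
  set pu : PhaseSpace L → ℝ := F L with hpu
  set pg : PhaseSpace L → ℝ := G L with hpg
  have hclu : ∀ x, (∑ w : Fin L → Bool, u (x.1, fun i => if w i then -x.2 i else x.2 i)) / 2 ^ L = pu x :=
    fun x => (flipAvg_closed_form_top u hθfin hF0 hFs x).symm
  have hclg : ∀ x, (∑ w : Fin L → Bool, g (x.1, fun i => if w i then -x.2 i else x.2 i)) / 2 ^ L = pg x :=
    fun x => (flipAvg_closed_form_top g hθfin hG0 hGs x).symm
  have hpu2 : MemLp pu 2 μ := flipAvg_memLp hθμ hu hF0 hFs L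
  have hpg2 : MemLp pg 2 μ := flipAvg_memLp hθμ hg hG0 hGs L
  have hpue : ∀ k, k < L → ∀ x, pu (θ k x) = pu x := fun k hk x => flipAvg_even hθi hθc hFs L k hk x
  have horth : ∫ x, (g x - pg x) * pu x ∂μ = 0 := flipAvg_orth hθμ hθi hg hG0 hGs L pu hpu2 hpue
  have i1 : Integrable (fun x => (u x - pu x) * g x) μ := (hu.sub hpu2).integrable_mul hg
  have i2 : Integrable (fun x => pu x * pg x) μ := hpu2.integrable_mul hpg2
  have i3 : Integrable (fun x => (g x - pg x) * pu x) μ := (hg.sub hpg2).integrable_mul hpu2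
  have i12 : Integrable (fun x => (u x - pu x) * g x + pu x * pg x) μ := i1.add i2
  have e : (fun x => u x * g x) = fun x => (u x - pu x) * g x + pu x * pg x + (g x - pg x) * pu x := by
    funext x; ring
  simp_rw [hclu, hclg]
  rw [e, integral_add i12 i3, integral_add i1 i2, horth, add_zero]

/-- Scalar Young inequality after Cauchy–Schwarz: `P² ≤ AB`, `A, B ≥ 0`, `θ > 0` give `P ≤ (θA + B/θ)/2`.
[folklore] -/
theorem le_of_sq_le_mul {P A B θ : ℝ} (h : P ^ 2 ≤ A * B) (hA : 0 ≤ A) (hB : 0 ≤ B) (hθ : 0 < θ) :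
    P ≤ (θ * A + θ⁻¹ * B) / 2 := by
  have hAB : A * B = (θ * A) * (θ⁻¹ * B) := by
    field_simp
  have h4 := four_mul_le_sq_add (θ * A) (θ⁻¹ * B)
  have h1 : P ^ 2 ≤ ((θ * A + θ⁻¹ * B) / 2) ^ 2 := by nlinarith [h, hAB, h4]
  have h0 : 0 ≤ (θ * A + θ⁻¹ * B) / 2 := by positivity
  exact (le_abs_self P).trans (abs_le_of_sq_le_sq h1 h0)

/-- `le_of_sq_le_mul` with a scalar factor: `(tP)² ≤ A·(t²B)`. [folklore] -/
theorem mul_le_of_sq_le_mul {P A B θ : ℝ} (t : ℝ) (h : P ^ 2 ≤ A * B) (hA : 0 ≤ A) (hB : 0 ≤ B)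
    (hθ : 0 < θ) : t * P ≤ (θ * A + θ⁻¹ * (t ^ 2 * B)) / 2 := by
  refine le_of_sq_le_mul ?_ hA (by positivity) hθ
  calc (t * P) ^ 2 = t ^ 2 * P ^ 2 := by ring
    _ ≤ t ^ 2 * (A * B) := mul_le_mul_of_nonneg_left h (sq_nonneg t)
    _ = A * (t ^ 2 * B) := by ring

end Abstract

/-! ## The energy identity and the pairing identity of a classical Abel corrector -/

section Chain

variable {ω₂ lam β γ : ℝ}

/-- The Summit-level Liouville operator `liouvilleOp` is the Literature Liouvillian `OscillatorChain.liouvillian`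
(same formula). [folklore] -/
theorem liouvilleOp_eq_liouvillian (P : OscillatorChain) (L : ℕ) (f : PhaseSpace L → ℝ) :
    liouvilleOp P L f = P.liouvillian L f := rfl

/-- **Energy identity of a classical Abel corrector.** If `u ∈ C² ∩ L²(μ_T)` solves `L_ε u = s u − J` pointwise with
`J ∈ L²(μ_T)`, then `∫ u J dμ_T = s‖u‖² + (ε/2) Σ_i ‖u∘F_i − u‖² + γT Σ_i B_i ‖∂_{p_i}u‖²`
(`Kubo.fluctuation_dissipation` for the forward pair `(u, (J − su) + εSu)` and the flip Dirichlet form).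
[cite: BernardinOlla2011, §3] -/
theorem corrector_energy_eq (hω : 0 < ω₂) (hl : 0 < lam) (hβ : 0 < β) (hγ : 0 < γ) {T : ℝ} (hT : 0 < T)
    (ε : ℝ) {L : ℕ} {s : ℝ} {u J : PhaseSpace L → ℝ} (hJ2 : MemLp J 2 ((pinnedChain ω₂ lam β γ).gibbsMeasure L T))
    (huC : ContDiff ℝ 2 u) (hu2 : MemLp u 2 ((pinnedChain ω₂ lam β γ).gibbsMeasure L T))
    (hpde : ∀ x, (pinnedChain ω₂ lam β γ).flipGenerator L T T ε u x = s * u x - J x) :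
    ∫ x, u x * J x ∂((pinnedChain ω₂ lam β γ).gibbsMeasure L T) =
      s * ∫ x, u x ^ 2 ∂((pinnedChain ω₂ lam β γ).gibbsMeasure L T) +
        ε / 2 * ∑ i, ∫ x, (u (momentumFlip i x) - u x) ^ 2 ∂((pinnedChain ω₂ lam β γ).gibbsMeasure L T) +
        γ * T * ∑ i, OscillatorChain.bathWeight L i *
          ∫ x, partialP i u x ^ 2 ∂((pinnedChain ω₂ lam β γ).gibbsMeasure L T) := by
  set P := pinnedChain ω₂ lam β γ with hP
  set μ := P.gibbsMeasure L T with hμ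
  set B := OscillatorChain.bathWeight L with hB
  have hflip := gibbs_flipInvariant (ω₂ := ω₂) (lam := lam) (β := β) (γ := γ) L T
  have hB0 : ∀ i, 0 ≤ B i := Literature.MathematicalPhysics.KineticTheory.HeatConduction.bathWeight_nonneg L
  have hSu2 : MemLp (flipNoise L u) 2 μ := memLp_flipNoise hflip hu2
  set kf : PhaseSpace L → ℝ := fun x => (J x - s * u x) + ε * flipNoise L u x with hkf
  have hkf2 : MemLp kf 2 μ := (hJ2.sub (hu2.const_mul s)).add (hSu2.const_mul ε)
  have hpu : ∀ x, 1 * liouvilleOp P L u x + γ * bathOp L B T u x = -kf x := fun x =>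
    flip_forwardPair (ω₂ := ω₂) (lam := lam) (β := β) (γ := γ) L T ε (k := fun y => J y - s * u y)
      (fun y => by
        show P.flipGenerator L T T ε u y = -(J y - s * u y)
        rw [hpde y]
        ring) x
  have hFD := fluctuation_dissipation hω hl.le hβ.le L hT B hB0 1 hγ huC hu2 hkf2 hpu
  -- Gibbs-measure form of the fluctuation–dissipation identity
  have hμFD : ∫ x, u x * kf x ∂μ = γ * T * ∑ i, B i * ∫ x, partialP i u x ^ 2 ∂μ := by
    have hDi : ∀ i, ∫ x, partialP i u x ^ 2 ∂μ =
        (∫ x, P.gibbsDensity L T x)⁻¹ * ∫ x, partialP i u x ^ 2 * P.gibbsDensity L T x := fun i =>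
      P.integral_gibbsMeasure _
    simp_rw [hDi]
    rw [P.integral_gibbsMeasure, hFD, Finset.mul_sum, Finset.mul_sum, Finset.mul_sum]
    exact Finset.sum_congr rfl fun i _ => by ring
  -- expand the source
  have i1 : Integrable (fun x => u x * J x) μ := hu2.integrable_mul hJ2
  have i2 : Integrable (fun x => u x ^ 2) μ := hu2.integrable_sq
  have i3 : Integrable (fun x => u x * flipNoise L u x) μ := hu2.integrable_mul hSu2
  have e : (fun x => u x * kf x) = fun x => u x * J x - s * u x ^ 2 + ε * (u x * flipNoise L u x) := by
    funext x
    simp only [hkf]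
    ring
  have i2' : Integrable (fun x => s * u x ^ 2) μ := i2.const_mul s
  have i12 : Integrable (fun x => u x * J x - s * u x ^ 2) μ := i1.sub i2'
  have i3' : Integrable (fun x => ε * (u x * flipNoise L u x)) μ := i3.const_mul ε
  rw [e, integral_add i12 i3', integral_sub i1 i2', integral_const_mul, integral_const_mul,
    Summit.AtomisticToContinuum.FouriersLaw.Theorems.VanishingNoiseBound.integral_mul_flipNoise_self hflip hu2]
    at hμFD
  linarith

/-- **Pairing identity** (`L_ε` moved across a classical corrector). If `u ∈ C² ∩ L²(μ_T)` solves
`L_ε u = s u − J` (`J ∈ L²(μ_T)`) and `w ∈ C²` has `w, Xw, L_{T,T}w ∈ L²(μ_T)`, then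
`∫ w J dμ_T = s∫uw + (ε/2)Σ_i ∫(u∘F_i − u)(w∘F_i − w) + ∫ u·Xw + γT Σ_i B_i ∫ ∂_{p_i}u ∂_{p_i}w`.
Proof: `w` is both a forward pair (source `−L_{T,T}w`) and a backward pair (source `Xw − γS_Bw`); average
`Kubo.polar` (two forward pairs) and `Kubo.cross` (forward against backward), then the polarised flip Dirichlet
form. [folklore] -/
theorem pairing_identity (hω : 0 < ω₂) (hl : 0 < lam) (hβ : 0 < β) (hγ : 0 < γ) {T : ℝ} (hT : 0 < T)
    (ε : ℝ) {L : ℕ} {s : ℝ} {u w J : PhaseSpace L → ℝ} (hJ2 : MemLp J 2 ((pinnedChain ω₂ lam β γ).gibbsMeasure L T))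
    (huC : ContDiff ℝ 2 u) (hu2 : MemLp u 2 ((pinnedChain ω₂ lam β γ).gibbsMeasure L T))
    (hpde : ∀ x, (pinnedChain ω₂ lam β γ).flipGenerator L T T ε u x = s * u x - J x)
    (hwC : ContDiff ℝ 2 w) (hw2 : MemLp w 2 ((pinnedChain ω₂ lam β γ).gibbsMeasure L T))
    (hXw2 : MemLp ((pinnedChain ω₂ lam β γ).liouvillian L w) 2 ((pinnedChain ω₂ lam β γ).gibbsMeasure L T))
    (hGw2 : MemLp ((pinnedChain ω₂ lam β γ).generator L T T w) 2 ((pinnedChain ω₂ lam β γ).gibbsMeasure L T)) :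
    ∫ x, w x * J x ∂((pinnedChain ω₂ lam β γ).gibbsMeasure L T) =
      s * ∫ x, u x * w x ∂((pinnedChain ω₂ lam β γ).gibbsMeasure L T) +
        ε / 2 * ∑ i, ∫ x, (u (momentumFlip i x) - u x) * (w (momentumFlip i x) - w x)
          ∂((pinnedChain ω₂ lam β γ).gibbsMeasure L T) +
        ∫ x, u x * (pinnedChain ω₂ lam β γ).liouvillian L w x ∂((pinnedChain ω₂ lam β γ).gibbsMeasure L T) +
        γ * T * ∑ i, OscillatorChain.bathWeight L i *
          ∫ x, partialP i u x * partialP i w x ∂((pinnedChain ω₂ lam β γ).gibbsMeasure L T) := by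
  set P := pinnedChain ω₂ lam β γ with hP
  set μ := P.gibbsMeasure L T with hμ
  set B := OscillatorChain.bathWeight L with hB
  have hflip := gibbs_flipInvariant (ω₂ := ω₂) (lam := lam) (β := β) (γ := γ) L T
  have hB0 : ∀ i, 0 ≤ B i := Literature.MathematicalPhysics.KineticTheory.HeatConduction.bathWeight_nonneg L
  have hSu2 : MemLp (flipNoise L u) 2 μ := memLp_flipNoise hflip hu2
  -- the corrector as a forward pair
  set kf : PhaseSpace L → ℝ := fun x => (J x - s * u x) + ε * flipNoise L u x with hkf
  have hkf2 : MemLp kf 2 μ := (hJ2.sub (hu2.const_mul s)).add (hSu2.const_mul ε)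
  have hpu : ∀ x, 1 * liouvilleOp P L u x + γ * bathOp L B T u x = -kf x := fun x =>
    flip_forwardPair (ω₂ := ω₂) (lam := lam) (β := β) (γ := γ) L T ε (k := fun y => J y - s * u y)
      (fun y => by
        show P.flipGenerator L T T ε u y = -(J y - s * u y)
        rw [hpde y]
        ring) x
  -- the test function as a forward pair and as a backward pair
  have hXw2' : MemLp (liouvilleOp P L w) 2 μ := hXw2
  set kw : PhaseSpace L → ℝ := fun x => -P.generator L T T w x with hkw
  have hkw2 : MemLp kw 2 μ := hGw2.neg
  have hpw : ∀ x, 1 * liouvilleOp P L w x + γ * bathOp L B T w x = -kw x := by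
    intro x
    simp only [hkw, neg_neg]
    rw [generator_eq_liouvilleOp_add_bathOp]
    show 1 * liouvilleOp P L w x + γ * bathOp L B T w x = liouvilleOp P L w x + γ * bathOp L B T w x
    ring
  set kw' : PhaseSpace L → ℝ := fun x => 2 * liouvilleOp P L w x + kw x with hkw'
  have hkw'2 : MemLp kw' 2 μ := (hXw2'.const_mul 2).add hkw2
  have hpw' : ∀ x, -1 * liouvilleOp P L w x + γ * bathOp L B T w x = -kw' x := by
    intro x
    have h := hpw x
    simp only [hkw'] at h ⊢
    linarith
  -- the two Green identities
  have hpol := polar hω hl.le hβ.le L hT B hB0 1 hγ huC hwC hu2 hw2 hkf2 hkw2 hpu hpw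
  have hcr := cross hω hl.le hβ.le L hT B hB0 1 hγ huC hwC hu2 hw2 hkf2 hkw'2 hpu hpw'
  -- density form of the pairing identity
  have hI1 : Integrable fun x => w x * kf x * P.gibbsDensity L T x :=
    integrable_mul_mul_gibbsDensity hω hl.le hβ.le γ L hT hw2 hkf2
  have hI2 : Integrable fun x => u x * kw x * P.gibbsDensity L T x :=
    integrable_mul_mul_gibbsDensity hω hl.le hβ.le γ L hT hu2 hkw2
  have hI3 : Integrable fun x => u x * liouvilleOp P L w x * P.gibbsDensity L T x :=
    integrable_mul_mul_gibbsDensity hω hl.le hβ.le γ L hT hu2 hXw2'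
  have hsplit1 : ∫ x, (w x * kf x + u x * kw x) * P.gibbsDensity L T x =
      (∫ x, w x * kf x * P.gibbsDensity L T x) + ∫ x, u x * kw x * P.gibbsDensity L T x := by
    rw [← integral_add hI1 hI2]
    exact integral_congr_ae (ae_of_all _ fun x => by ring)
  have hsplit2 : ∫ x, u x * kw' x * P.gibbsDensity L T x =
      2 * (∫ x, u x * liouvilleOp P L w x * P.gibbsDensity L T x) + ∫ x, u x * kw x * P.gibbsDensity L T x := by
    rw [← integral_const_mul, ← integral_add (hI3.const_mul 2) hI2]
    exact integral_congr_ae (ae_of_all _ fun x => by simp only [hkw']; ring)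
  have hρ : ∫ x, w x * kf x * P.gibbsDensity L T x =
      (∫ x, u x * liouvilleOp P L w x * P.gibbsDensity L T x) +
        γ * T * ∑ i, B i * ∫ x, partialP i u x * partialP i w x * P.gibbsDensity L T x := by
    rw [hsplit1] at hpol
    rw [hsplit2] at hcr
    linarith
  -- Gibbs-measure form
  have hμ1 : ∫ x, w x * kf x ∂μ = (∫ x, u x * liouvilleOp P L w x ∂μ) +
      γ * T * ∑ i, B i * ∫ x, partialP i u x * partialP i w x ∂μ := by
    have hDi : ∀ i, ∫ x, partialP i u x * partialP i w x ∂μ =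
        (∫ x, P.gibbsDensity L T x)⁻¹ * ∫ x, partialP i u x * partialP i w x * P.gibbsDensity L T x := fun i =>
      P.integral_gibbsMeasure _
    simp_rw [hDi]
    rw [P.integral_gibbsMeasure, P.integral_gibbsMeasure, hρ, mul_add, Finset.mul_sum, Finset.mul_sum,
      Finset.mul_sum]
    congr 1
    exact Finset.sum_congr rfl fun i _ => by ring
  -- expand the source and use the polarised flip Dirichlet form
  have i1 : Integrable (fun x => w x * J x) μ := hw2.integrable_mul hJ2
  have i2 : Integrable (fun x => u x * w x) μ := hu2.integrable_mul hw2
  have i3 : Integrable (fun x => w x * flipNoise L u x) μ := hw2.integrable_mul hSu2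
  have e : (fun x => w x * kf x) = fun x => w x * J x - s * (u x * w x) + ε * (w x * flipNoise L u x) := by
    funext x
    simp only [hkf]
    ring
  have hS : ∫ x, w x * flipNoise L u x ∂μ =
      -(1 / 2) * ∑ i, ∫ x, (u (momentumFlip i x) - u x) * (w (momentumFlip i x) - w x) ∂μ := by
    rw [integral_mul_flipNoise_polar hflip hu2 hw2]
    congr 1
    exact Finset.sum_congr rfl fun i _ => integral_congr_ae (ae_of_all _ fun x => by ring)
  have i2' : Integrable (fun x => s * (u x * w x)) μ := i2.const_mul s
  have i12 : Integrable (fun x => w x * J x - s * (u x * w x)) μ := i1.sub i2'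
  have i3' : Integrable (fun x => ε * (w x * flipNoise L u x)) μ := i3.const_mul ε
  rw [e, integral_add i12 i3', integral_sub i1 i2', integral_const_mul, integral_const_mul, hS] at hμ1
  rw [← liouvilleOp_eq_liouvillian]
  linarith

end Chain

/-! ## Registered helper (notation-free restatement) -/

/-- Registered helper sub-goal `helper_abelCorrectorPairingIdentity` of crux stmt-AtomisticToContinuum-11977 (line
`abel-storage-decay`, stub B `stub_bulkAbelGKPositivity`): the pairing identity `pairing_identity` for classical
Abel correctors against `C²` test functions with `w, Xw, L_{T,T}w ∈ L²(μ_T)`, restated. [folklore] -/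
theorem helper_abelCorrectorPairingIdentity : ∀ (ω₂ lam β γ T ε s : ℝ), 0 < ω₂ → 0 < lam → 0 < β → 0 < γ → 0 < T → ∀ (L : ℕ) (u w J : Literature.MathematicalPhysics.KineticTheory.HeatConduction.PhaseSpace L → ℝ), MeasureTheory.MemLp J 2 ((Literature.MathematicalPhysics.KineticTheory.HeatConduction.pinnedChain ω₂ lam β γ).gibbsMeasure L T) → ContDiff ℝ 2 u → MeasureTheory.MemLp u 2 ((Literature.MathematicalPhysics.KineticTheory.HeatConduction.pinnedChain ω₂ lam β γ).gibbsMeasure L T) → (∀ x, (Literature.MathematicalPhysics.KineticTheory.HeatConduction.pinnedChain ω₂ lam β γ).flipGenerator L T T ε u x = s * u x - J x) → ContDiff ℝ 2 w → MeasureTheory.MemLp w 2 ((Literature.MathematicalPhysics.KineticTheory.HeatConduction.pinnedChain ω₂ lam β γ).gibbsMeasure L T) → MeasureTheory.MemLp ((Literature.MathematicalPhysics.KineticTheory.HeatConduction.pinnedChain ω₂ lam β γ).liouvillian L w) 2 ((Literature.MathematicalPhysics.KineticTheory.HeatConduction.pinnedChain ω₂ lam β γ).gibbsMeasure L T) → MeasureTheory.MemLp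 ((Literature.MathematicalPhysics.KineticTheory.HeatConduction.pinnedChain ω₂ lam β γ).generator L T T w) 2 ((Literature.MathematicalPhysics.KineticTheory.HeatConduction.pinnedChain ω₂ lam β γ).gibbsMeasure L T) → MeasureTheory.integral ((Literature.MathematicalPhysics.KineticTheory.HeatConduction.pinnedChain ω₂ lam β γ).gibbsMeasure L T) (fun x => w x * J x) = s * MeasureTheory.integral ((Literature.MathematicalPhysics.KineticTheory.HeatConduction.pinnedChain ω₂ lam β γ).gibbsMeasure L T) (fun x => u x * w x) + ε / 2 * ∑ i : Fin L, MeasureTheory.integral ((Literature.MathematicalPhysics.KineticTheory.HeatConduction.pinnedChain ω₂ lam β γ).gibbsMeasure L T) (fun x => (u (Literature.MathematicalPhysics.KineticTheory.HeatConduction.momentumFlip i x) - u x) * (w (Literature.MathematicalPhysics.KineticTheory.HeatConduction.momentumFlip i x) - w x)) + MeasureTheory.integral ((Literature.MathematicalPhysics.KineticTheory.HeatConduction.pinnedChain ω₂ lam β γ).gibbsMeasure L T) (fun x => u x * (Literature.MathematicalPhysics.KineticTheory.HeatConduction.pinnedChain ω₂ lam β γ).liouvillian L w x) + γ * T * ∑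 i : Fin L, Literature.MathematicalPhysics.KineticTheory.HeatConduction.OscillatorChain.bathWeight L i * MeasureTheory.integral ((Literature.MathematicalPhysics.KineticTheory.HeatConduction.pinnedChain ω₂ lam β γ).gibbsMeasure L T) (fun x => Literature.MathematicalPhysics.KineticTheory.HeatConduction.partialP i u x * Literature.MathematicalPhysics.KineticTheory.HeatConduction.partialP i w x) :=
  fun _ _ _ _ _ ε _ hω hl hβ hγ hT _ _ _ _ hJ2 huC hu2 hpde hwC hw2 hXw2 hGw2 =>
    pairing_identity hω hl hβ hγ hT ε hJ2 huC hu2 hpde hwC hw2 hXw2 hGw2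

end Summit.AtomisticToContinuum.FouriersLaw.Theorems.NoisyFourier.AbelThomson

end
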